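import Summits.QuantumFields.YangMills.Theorems.AllWindowsColdBoxBoxHighLineCum3TriangleMuSet
import Summits.QuantumFields.YangMills.Theorems.AllWindowsColdBoxBoxHighLineCum3TriangleGhostHaar
import Summits.QuantumFields.YangMills.Theorems.AllWindowsColdBoxBoxHighLineEdgeTwoCentreSums
import Summits.QuantumFields.YangMills.Theorems.AllWindowsColdBoxBoxHighLineSmallFieldInsideFPCore

/-!
# K3′(a) ON THE CUT SET, UNIFORM and BY NAME for the two quadratic vertices — `κ₃^{μ_{D′}}(L_x, L_y; quadVal M_H)` (ghost) and `κ₃^{μ_{D′}}(L_x, L_y; quadVal (m·1))` (mass)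
# (planner ym-idea-2 g18's ruling 2026-08-30T01:12:48Z «β-letter sum of K3′(a) ✓p753741 → w5»; fcl-p3 g27's hK3 row-sum takes these as named hypotheses;
#  `Cruxes/BoxWindowHighSU2213/ASSEMBLY-U5.md` §3; LINE-20 U5 ⟨stmt-QuantumFields-24336⟩)

Width seat `ym-line-sfw-p2-w5` (prover-ym-line-sfw-p2-w5-g24-0).  fcl-p3 g27's ✓`GaussRestrict.abs_tiltCum3_muSet_linCurvSq_linCurvSq_quadVal_le` (K3′(a): the quadratic-vertex
triangle on `μ_{D′}` for a generic symmetric kernel `|M i j| ≤ C_M/(1+d)⁴`, with the `√τ`-transfer summand `√τ·C(1+log H)²H²√(ΣM²)/β³`) made UNIFORM in the base points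
(`(1+‖x−y‖₁)⁻⁴ ≤ 1` — the assembler's floor `40e/H⁸` is uniform) and INSTANTIATED at the two quadratic vertices of `tiltU` (w3 g41's ✓`…Cum3TriangleGhostHaar` letters):

* `sum_sq_le_of_kernel_decay` — `|K i j| ≤ C_K/(1+d)⁴ ⇒ Σ_{ij} K(i,j)² ≤ C·C_K²·H⁴·(1+log H)` (✓`EdgeSums.edgeShellSums` (4), `|LandauFree H| ≤ 216H⁴`);
* ★★ `abs_tiltCum3_muSet_linCurvSq_linCurvSq_quadVal_le_uniform` — the generic row: `|κ₃^{μ_{D′}}(quadVal M; L_x, L_y)| ≤ β⁻¹^3·C·C_M·(1+log H)⁵·(1 + √τ·H⁴)`;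
* ★★ `abs_tiltCum3_muSet_linCurvSq_linCurvSq_ghostM_le` — `|κ₃^{μ_{D′}}(quadVal (ghostM H); L_x, L_y)| ≤ β⁻¹^3·C·(1+log H)⁵·(1 + √τ·H⁴)`;
* ★★ `abs_tiltCum3_muSet_linCurvSq_linCurvSq_quadVal_smul_one_le` — `|κ₃^{μ_{D′}}(quadVal (m·1); L_x, L_y)| ≤ β⁻¹^3·C·|m|·(1+log H)⁵·(1 + √τ·H⁴)`;
for every `H ≥ 1`, `β > 0`, measurable `D′ ⊆ smallField H s` (`s ≥ 0`), `E₀[1 − 1_{D′}] ≤ τ ≤ 1/2`, all `x y μ₁ ν₁ μ₂ ν₂` (relative to the floor: `H⁸(1+log H)⁵/β` and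
`√τ·H¹²(1+log H)⁵/β` — q-demand of the `√τ` term: `q > 24θ − 2`, i.e. `q ≥ 1` suffices for `θ < 1/8`).

Tree only; no definitions; standard axioms.  HONEST LABEL: U5 prep, helper-grade (one row of hK3′); U5 ⟨24336⟩ UNSTAFFED/OPEN, ⟨24004⟩ OPEN; route AllWindowsColdBox DRAFT;
no crux, rung or summit is proved; **the Yang–Mills mass gap is NOT proved by this file; no summit is proved by a line.**
-/

set_option autoImplicit false

noncomputable section

open MeasureTheory Matrix Finset
open Literature.Probability.LatticeModels (Site)
open Literature.MathematicalPhysics.QuantumFieldTheory (Plaq)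

namespace Summit.QuantumFields.YangMills.Theorems.AllWindowsColdBoxBoxHighLine

namespace GaussRestrict

variable {H : ℕ} {β : ℝ}

/-! ## §1 The Hilbert–Schmidt size of the ghost kernel -/

/-- **Hilbert–Schmidt size from kernel decay**: if `|K i j| ≤ C_K/(1+d(i,j))⁴` then `Σ_{ij} K(i,j)² ≤ C·C_K²·H⁴·(1+log H)`
(squared decay `≤ C_K²/(1+d)⁴`, edge shell sum `(4)` ✓`EdgeSums.edgeShellSums`, `3·|LandauFree H| ≤ 648H⁴` rows). -/
theorem sum_sq_le_of_kernel_decay : ∃ C : ℝ, 0 ≤ C ∧ ∀ H : ℕ, 1 ≤ H → ∀ CK : ℝ, 0 ≤ CK →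
    ∀ K : Matrix (LandauFree H × Fin 3) (LandauFree H × Fin 3) ℝ,
    (∀ i j : LandauFree H × Fin 3, |K i j| ≤ CK / (1 + siteDist (i.1.1.1).1 (j.1.1.1).1) ^ 4) →
    ∑ i : LandauFree H × Fin 3, ∑ j : LandauFree H × Fin 3, K i j ^ 2 ≤ C * CK ^ 2 * (H : ℝ) ^ 4 * (1 + Real.log H) := by
  obtain ⟨CE, hCE0, hE⟩ := EdgeSums.edgeShellSums
  refine ⟨648 * 3 * CE, by positivity, fun H hH CK hCK K hK => ?_⟩
  have hrow : ∀ i : LandauFree H × Fin 3, ∑ j : LandauFree H × Fin 3, K i j ^ 2 ≤ 3 * CK ^ 2 * (CE * (1 + Real.log H)) := by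
    intro i
    have hterm : ∀ j : LandauFree H × Fin 3, K i j ^ 2 ≤ CK ^ 2 * (1 / (1 + siteDist j.1.1.1.1 (i.1.1.1).1) ^ 4) := by
      intro j
      have h1 := hK i j
      have h2 : K i j ^ 2 ≤ (CK / (1 + siteDist (i.1.1.1).1 (j.1.1.1).1) ^ 4) ^ 2 := by
        rw [← sq_abs]; exact pow_le_pow_left₀ (abs_nonneg _) h1 2
      refine h2.trans ?_
      rw [div_pow, ← pow_mul, EdgeChartGaussian.siteDist_comm (i.1.1.1).1]
      have h4 : (1 + siteDist (j.1.1.1).1 (i.1.1.1).1) ^ 4 ≤ (1 + siteDist (j.1.1.1).1 (i.1.1.1).1) ^ (4 * 2) :=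
        pow_le_pow_right₀ (by linarith [GhostKernel.siteDist_nonneg (j.1.1.1).1 (i.1.1.1).1]) (by norm_num)
      have hp : 0 < (1 + siteDist (j.1.1.1).1 (i.1.1.1).1) ^ 4 := by
        have := GhostKernel.siteDist_nonneg (j.1.1.1).1 (i.1.1.1).1; positivity
      rw [mul_one_div]
      exact div_le_div_of_nonneg_left (sq_nonneg _) hp h4
    calc ∑ j : LandauFree H × Fin 3, K i j ^ 2
        ≤ ∑ j : LandauFree H × Fin 3, CK ^ 2 * (1 / (1 + siteDist j.1.1.1.1 (i.1.1.1).1) ^ 4) := Finset.sum_le_sum fun j _ => hterm j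
      _ = CK ^ 2 * (3 * ∑ e : LandauFree H, 1 / (1 + siteDist e.1.1.1 (i.1.1.1).1) ^ 4) := by
          rw [← Finset.mul_sum, Fintype.sum_prod_type]
          simp only [Finset.sum_const, Finset.card_univ, Fintype.card_fin, nsmul_eq_mul, Nat.cast_ofNat]
          simp only [Finset.mul_sum]
      _ ≤ CK ^ 2 * (3 * (CE * (1 + Real.log H))) :=
          mul_le_mul_of_nonneg_left (mul_le_mul_of_nonneg_left ((hE H hH (i.1.1.1).1).2.1) (by norm_num)) (sq_nonneg _)
      _ = 3 * CK ^ 2 * (CE * (1 + Real.log H)) := by ring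
  have hcard : (Fintype.card (LandauFree H × Fin 3) : ℝ) ≤ 648 * (H : ℝ) ^ 4 := by
    rw [Fintype.card_prod, Fintype.card_fin, Nat.cast_mul]
    have := SmallFieldFP.card_landauFree_le hH
    push_cast; nlinarith
  calc ∑ i : LandauFree H × Fin 3, ∑ j : LandauFree H × Fin 3, K i j ^ 2
      ≤ ∑ _i : LandauFree H × Fin 3, 3 * CK ^ 2 * (CE * (1 + Real.log H)) := Finset.sum_le_sum fun i _ => hrow i
    _ = (Fintype.card (LandauFree H × Fin 3) : ℝ) * (3 * CK ^ 2 * (CE * (1 + Real.log H))) := by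
        rw [Finset.sum_const, Finset.card_univ, nsmul_eq_mul]
    _ ≤ 648 * (H : ℝ) ^ 4 * (3 * CK ^ 2 * (CE * (1 + Real.log H))) := by
        have hL : 0 ≤ 1 + Real.log (H : ℝ) := by
          have : (1 : ℝ) ≤ H := by exact_mod_cast hH
          have := Real.log_nonneg this; linarith
        exact mul_le_mul_of_nonneg_right hcard (by positivity)
    _ = 648 * 3 * CE * CK ^ 2 * (H : ℝ) ^ 4 * (1 + Real.log H) := by ring

/-- **A quadratic vertex with a decaying symmetric kernel on the cut set, UNIFORM in the base points**: for `|M i j| ≤ C_M/(1+d)⁴`, `M` symmetric,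
`|κ₃^{μ_{D′}}(quadVal M; L_x, L_y)| ≤ β⁻¹^3·C·C_M·(1+log H)⁵·(1 + √τ·H⁴)` (✓p753741 with `(1+‖x−y‖₁)⁻⁴ ≤ 1` and `√(ΣM²) ≤ √C·C_M·H²·(1+log H)`). -/
theorem abs_tiltCum3_muSet_linCurvSq_linCurvSq_quadVal_le_uniform : ∃ C : ℝ, 0 ≤ C ∧ ∀ H : ℕ, 1 ≤ H → ∀ β : ℝ, 0 < β →
    ∀ CM : ℝ, 0 ≤ CM → ∀ M : Matrix (LandauFree H × Fin 3) (LandauFree H × Fin 3) ℝ, M.IsSymm →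
    (∀ i j : LandauFree H × Fin 3, |M i j| ≤ CM / (1 + siteDist (i.1.1.1).1 (j.1.1.1).1) ^ 4) →
    ∀ x y : Site 4, ∀ μ₁ ν₁ μ₂ ν₂ : Fin 4, ∀ s : ℝ, 0 ≤ s → ∀ D : Set (LandauFree H → E3), MeasurableSet D → D ⊆ smallField H s →
    ∀ τ : ℝ, gaussAvg β H (fun a => 1 - D.indicator (fun _ => (1 : ℝ)) a) ≤ τ → τ ≤ 1 / 2 →
    |Tilt.tiltCum3 ((((volume : Measure (LandauFree H → E3)).restrict D).withDensity fun a => ENNReal.ofReal (gaussWeight β H a)))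
        (quadVal M) 0 (linCurvSq H (x, μ₁, ν₁)) (linCurvSq H (y, μ₂, ν₂))| ≤
      β⁻¹ ^ 3 * (C * CM * (1 + Real.log H) ^ 5 * (1 + Real.sqrt τ * (H : ℝ) ^ 4)) := by
  obtain ⟨C, hC0, h⟩ := abs_tiltCum3_muSet_linCurvSq_linCurvSq_quadVal_le
  obtain ⟨CS, hCS0, hS⟩ := sum_sq_le_of_kernel_decay
  refine ⟨C + C * Real.sqrt CS, by positivity, fun H hH β hβ CM hCM M hMs hMk x y μ₁ ν₁ μ₂ ν₂ s hs0 D hDm hDs τ hτ hτ2 => ?_⟩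
  have h1 := h H hH β hβ CM hCM M hMs hMk x y μ₁ ν₁ μ₂ ν₂ s hs0 D hDm hDs τ hτ hτ2
  have hH1 : (1 : ℝ) ≤ H := by exact_mod_cast hH
  have hL1 : 1 ≤ 1 + Real.log (H : ℝ) := by have := Real.log_nonneg hH1; linarith
  have hL0 : 0 ≤ 1 + Real.log (H : ℝ) := zero_le_one.trans hL1
  have hτ0 : 0 ≤ τ := le_trans (EdgeChartGaussian.gaussAvg_nonneg H hβ fun a => by
    by_cases ha : a ∈ D <;> simp [Set.indicator, ha]) hτ
  have hden : 1 ≤ (1 + (((∑ m : Fin 4, |x m - y m|) : ℤ) : ℝ)) ^ 4 := by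
    refine one_le_pow₀ ?_
    have : (0 : ℝ) ≤ (((∑ m : Fin 4, |x m - y m|) : ℤ) : ℝ) := by exact_mod_cast Finset.sum_nonneg fun m _ => abs_nonneg _
    linarith
  have hA : C * CM * (1 + Real.log (H : ℝ)) ^ 5 / (1 + (((∑ m : Fin 4, |x m - y m|) : ℤ) : ℝ)) ^ 4 ≤ C * CM * (1 + Real.log (H : ℝ)) ^ 5 :=
    div_le_self (by positivity) hden
  have hsq : Real.sqrt (∑ i, ∑ j, M i j ^ 2) ≤ Real.sqrt CS * CM * (H : ℝ) ^ 2 * (1 + Real.log H) := by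
    have h2 : Real.sqrt (∑ i, ∑ j, M i j ^ 2) ≤ Real.sqrt (CS * CM ^ 2 * (H : ℝ) ^ 4 * (1 + Real.log H)) := Real.sqrt_le_sqrt (hS H hH CM hCM M hMk)
    refine h2.trans ((Real.sqrt_le_sqrt ?_).trans (le_of_eq (Real.sqrt_sq (by positivity))))
    have e : (Real.sqrt CS * CM * (H : ℝ) ^ 2 * (1 + Real.log H)) ^ 2 = CS * CM ^ 2 * (H : ℝ) ^ 4 * (1 + Real.log H) ^ 2 := by
      rw [mul_pow, mul_pow, mul_pow, Real.sq_sqrt hCS0]; ring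
    rw [e]
    have : (1 + Real.log (H : ℝ)) ≤ (1 + Real.log (H : ℝ)) ^ 2 := by nlinarith
    exact mul_le_mul_of_nonneg_left this (by positivity)
  have hB : Real.sqrt τ * (C * (1 + Real.log (H : ℝ)) ^ 2 * (H : ℝ) ^ 2 * Real.sqrt (∑ i, ∑ j, M i j ^ 2) / β ^ 3) ≤
      Real.sqrt τ * (C * Real.sqrt CS * CM * (1 + Real.log (H : ℝ)) ^ 5 * (H : ℝ) ^ 4) * β⁻¹ ^ 3 := by
    have hL3 : (1 + Real.log (H : ℝ)) ^ 3 ≤ (1 + Real.log (H : ℝ)) ^ 5 := pow_le_pow_right₀ hL1 (by norm_num)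
    have hnum : C * (1 + Real.log (H : ℝ)) ^ 2 * (H : ℝ) ^ 2 * Real.sqrt (∑ i, ∑ j, M i j ^ 2) ≤
        C * Real.sqrt CS * CM * (1 + Real.log (H : ℝ)) ^ 5 * (H : ℝ) ^ 4 := by
      calc C * (1 + Real.log (H : ℝ)) ^ 2 * (H : ℝ) ^ 2 * Real.sqrt (∑ i, ∑ j, M i j ^ 2)
          ≤ C * (1 + Real.log (H : ℝ)) ^ 2 * (H : ℝ) ^ 2 * (Real.sqrt CS * CM * (H : ℝ) ^ 2 * (1 + Real.log H)) := mul_le_mul_of_nonneg_left hsq (by positivity)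
        _ = C * Real.sqrt CS * CM * (1 + Real.log (H : ℝ)) ^ 3 * (H : ℝ) ^ 4 := by ring
        _ ≤ C * Real.sqrt CS * CM * (1 + Real.log (H : ℝ)) ^ 5 * (H : ℝ) ^ 4 :=
            mul_le_mul_of_nonneg_right (mul_le_mul_of_nonneg_left hL3 (by positivity)) (by positivity)
    rw [div_eq_mul_inv, ← inv_pow, ← mul_assoc]
    exact mul_le_mul_of_nonneg_right (mul_le_mul_of_nonneg_left hnum (Real.sqrt_nonneg _)) (by positivity)
  refine h1.trans ?_
  have e : β⁻¹ ^ 3 * ((C + C * Real.sqrt CS) * CM * (1 + Real.log (H : ℝ)) ^ 5 * (1 + Real.sqrt τ * (H : ℝ) ^ 4)) =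
      β⁻¹ ^ 3 * (C * CM * (1 + Real.log (H : ℝ)) ^ 5) + Real.sqrt τ * (C * Real.sqrt CS * CM * (1 + Real.log (H : ℝ)) ^ 5 * (H : ℝ) ^ 4) * β⁻¹ ^ 3 +
      (β⁻¹ ^ 3 * (C * Real.sqrt CS * CM * (1 + Real.log (H : ℝ)) ^ 5) + Real.sqrt τ * (C * CM * (1 + Real.log (H : ℝ)) ^ 5 * (H : ℝ) ^ 4) * β⁻¹ ^ 3) := by
    ring
  rw [e]
  have hextra : 0 ≤ β⁻¹ ^ 3 * (C * Real.sqrt CS * CM * (1 + Real.log (H : ℝ)) ^ 5) +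
      Real.sqrt τ * (C * CM * (1 + Real.log (H : ℝ)) ^ 5 * (H : ℝ) ^ 4) * β⁻¹ ^ 3 := by positivity
  have hβ3 : 0 ≤ β⁻¹ ^ 3 := by positivity
  linarith [mul_le_mul_of_nonneg_left hA hβ3, hB, hextra]

/-! ## §2 The two quadratic vertices on `μ_{D′}`, uniform in the base points -/

/-- ★★ **Ghost vertex on the cut set, uniform**: `|κ₃^{μ_{D′}}(quadVal (ghostM H); L_x, L_y)| ≤ β⁻¹^3·C·(1+log H)⁵·(1 + √τ·H⁴)`. -/
theorem abs_tiltCum3_muSet_linCurvSq_linCurvSq_ghostM_le : ∃ C : ℝ, 0 ≤ C ∧ ∀ H : ℕ, 1 ≤ H → ∀ β : ℝ, 0 < β →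
    ∀ x y : Site 4, ∀ μ₁ ν₁ μ₂ ν₂ : Fin 4, ∀ s : ℝ, 0 ≤ s → ∀ D : Set (LandauFree H → E3), MeasurableSet D → D ⊆ smallField H s →
    ∀ τ : ℝ, gaussAvg β H (fun a => 1 - D.indicator (fun _ => (1 : ℝ)) a) ≤ τ → τ ≤ 1 / 2 →
    |Tilt.tiltCum3 ((((volume : Measure (LandauFree H → E3)).restrict D).withDensity fun a => ENNReal.ofReal (gaussWeight β H a)))
        (quadVal (GhostFP.ghostM H)) 0 (linCurvSq H (x, μ₁, ν₁)) (linCurvSq H (y, μ₂, ν₂))| ≤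
      β⁻¹ ^ 3 * (C * (1 + Real.log H) ^ 5 * (1 + Real.sqrt τ * (H : ℝ) ^ 4)) := by
  obtain ⟨C, hC0, h⟩ := abs_tiltCum3_muSet_linCurvSq_linCurvSq_quadVal_le_uniform
  obtain ⟨CG, hCG0, hG⟩ := GhostFP.abs_ghostM_le
  refine ⟨C * CG, by positivity, fun H hH β hβ x y μ₁ ν₁ μ₂ ν₂ s hs0 D hDm hDs τ hτ hτ2 => ?_⟩
  have h1 := h H hH β hβ CG hCG0 (GhostFP.ghostM H) (Cum3Triangle.ghostM_isSymm H) (hG H hH) x y μ₁ ν₁ μ₂ ν₂ s hs0 D hDm hDs τ hτ hτ2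
  simpa only [mul_assoc] using h1

/-- ★★ **Mass vertex on the cut set, uniform**: `|κ₃^{μ_{D′}}(quadVal (m·1); L_x, L_y)| ≤ β⁻¹^3·C·|m|·(1+log H)⁵·(1 + √τ·H⁴)`. -/
theorem abs_tiltCum3_muSet_linCurvSq_linCurvSq_quadVal_smul_one_le : ∃ C : ℝ, 0 ≤ C ∧ ∀ H : ℕ, 1 ≤ H → ∀ β : ℝ, 0 < β → ∀ m : ℝ,
    ∀ x y : Site 4, ∀ μ₁ ν₁ μ₂ ν₂ : Fin 4, ∀ s : ℝ, 0 ≤ s → ∀ D : Set (LandauFree H → E3), MeasurableSet D → D ⊆ smallField H s →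
    ∀ τ : ℝ, gaussAvg β H (fun a => 1 - D.indicator (fun _ => (1 : ℝ)) a) ≤ τ → τ ≤ 1 / 2 →
    |Tilt.tiltCum3 ((((volume : Measure (LandauFree H → E3)).restrict D).withDensity fun a => ENNReal.ofReal (gaussWeight β H a)))
        (quadVal (m • (1 : Matrix (LandauFree H × Fin 3) (LandauFree H × Fin 3) ℝ))) 0 (linCurvSq H (x, μ₁, ν₁)) (linCurvSq H (y, μ₂, ν₂))| ≤
      β⁻¹ ^ 3 * (C * |m| * (1 + Real.log H) ^ 5 * (1 + Real.sqrt τ * (H : ℝ) ^ 4)) := by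
  obtain ⟨C, hC0, h⟩ := abs_tiltCum3_muSet_linCurvSq_linCurvSq_quadVal_le_uniform
  refine ⟨C, hC0, fun H hH β hβ m x y μ₁ ν₁ μ₂ ν₂ s hs0 D hDm hDs τ hτ hτ2 => ?_⟩
  exact h H hH β hβ |m| (abs_nonneg m) _ (Cum3Triangle.smul_one_isSymm m) (Cum3Triangle.abs_smul_one_apply_le m)
    x y μ₁ ν₁ μ₂ ν₂ s hs0 D hDm hDs τ hτ hτ2

end GaussRestrict

end Summit.QuantumFields.YangMills.Theorems.AllWindowsColdBoxBoxHighLine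

end
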